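import Summits.HodgeConjecture.CorCM.AbelianTwoPowerCyclicOverRealQuadratic
import Summits.HodgeConjecture.CorCM.AbelianSixteenSquaresInConj
import Summits.HodgeConjecture.HodgeConjecture.Theorems.Ring2ClassTargets
import Literature.AlgebraicGeometry.Pohlmann1968.SimpleCMAbelianVarietyPowersDivisorGenerated
import Literature.AlgebraicGeometry.ComplexMultiplication.PrincipalModelOfCMOrder
import Literature.NumberTheory.ComplexMultiplication.CMTypeDictionary
import Literature.AlgebraicGeometry.Motives.AbelianVarietySimpleOfIsogeny
import HarnessLib

/-!
# Simple abelian varieties with an action of an abelian CM field of `2`-power degree which is cyclic over `ℚ` or a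
# real quadratic field — or of degree `16` with all Galois squares in `{1, c}`: the Hodge conjecture for everything
# isogenous to a power (intrinsic forms and class-target displays)

COR-CM (cell `pub-hodgecm2`), binder seat b04 (gen 15), count-neutral claim ABELIAN-2POWER-CLASSIF, part IV (the
binders); capstone of parts Ia/Ib (`CorCM/AbelianTwoPowerThinKernel`, `…CyclicOverRealQuadratic`) and IIa–IIc
(`CorCM/AbelianSixteenStabilisers{,B}`, `AbelianSixteenSquaresInConj`), in the format of gen 13/14's binders
(`OcticCMFieldAutomorphismsBinders`, `GaloisDodecicBinders`).  KERNEL ONLY: theorems, no definition, no named fact,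
no `sorry`.  `HC_CM` is NOT used and NOT claimed: every statement is the Hodge conjecture for a NAMED SUB-CLASS of
complex abelian varieties, UNCONDITIONAL.

The type-level theorems take a realisation `(A, ι, θ)` of a CM type as data.  Here they are read on a SIMPLE complex
abelian variety `X` of dimension `2^n` with a ring homomorphism `φ : F →+* End⁰(X)` from a CM field `F` of degree
`2^{n+1}` — via Shimura's principal model in the isogeny class (`exists_principal_pair`, §7.1 Prop. 7) realising the CM
type of the pair (`isCMTypeRealisation_cmTypeOfPair`, §5.2), simplicity along isogenies, and the isogeny invariance
of `B = D` / of the Hodge conjecture (van Geemen 3.7):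

* **`hodgeConjectureFor_of_isIsogenous_powSucc_of_ringHom_of_isCyclic_over`** — `F` Galois with ABELIAN Galois
  group of order `2^{n+1}`, CYCLIC over a subfield `L ⊆ F⁺` of degree `≤ 2` (over `ℚ`, or over a real quadratic
  field): for every SIMPLE `X` of dimension `2^n` with `φ : F →+* End⁰(X)`, every complex abelian variety isogenous
  to a power `X^{N+1}` is divisor-generated and satisfies the Hodge conjecture;
* **`hodgeConjectureFor_of_isIsogenous_powSucc_of_ringHom_of_sq_eq_one_or_conj`** — `F` abelian of degree `16` with
  `g² ∈ {1, c}` for all `g ∈ Gal(F/ℚ)` (multiquadratic, or cyclic-quartic-CM times real-biquadratic), `X` a simple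
  EIGHTFOLD; **`…_multiquadratic`** — all `g² = 1`;
* the class-target displays (`Ring2.ClassTargets.HCOnClass`): `hcOnClass_isIsogenous_powSucc_simple_abelianTwoPowerCM_cyclicOverReal`,
  `hcOnClass_isIsogenous_powSucc_simpleEightfold_multiquadraticCM`.

## References
* [Shimura1998] G. Shimura, *Abelian Varieties with Complex Multiplication and Modular Functions*, §5.2, §7.1
  Prop. 7, §8.2 Prop. 26.
* [vanGeemen1994HodgeAV] B. van Geemen, LNM 1594 (1994), Lemma 3.7.
* [Gordon1999HodgeAVSurvey] B. B. Gordon, Thm. 6.4, 9.4.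
* [Kubota1965] T. Kubota, Trans. AMS 118 (1965), §4 Lemma 2.
* [Deligne2000] P. Deligne, *The Hodge conjecture* (Clay, 2000), §1.
-/

noncomputable section

open CategoryTheory CategoryTheory.Limits NumberField

namespace Summit.HodgeConjecture.CorCM.ThinKernel

open Literature.NumberTheory.ComplexMultiplication
open Literature.AlgebraicGeometry Literature.AlgebraicGeometry.Motives Literature.AlgebraicGeometry.HodgeTheory
open Literature.AlgebraicGeometry.Motives.AbelianVariety
open Literature.AlgebraicGeometry.ComplexMultiplication
open Literature.AlgebraicGeometry.Pohlmann1968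
open Summit.HodgeConjecture.HodgeConjecture.Ring2.ClassTargets
open Summit.HodgeConjecture.CorCM.AbelianSixteen (isNondegenerate_of_isPrimitive_of_sq_eq_one_or_conj)

variable {F : Type} [Field F] [NumberField F] [IsCMField F] [IsGalois ℚ F]

/-! ### §1 From `φ : F →+* End⁰(X)` to a nondegenerate realisation in the isogeny class -/

/-- **Principal model with a nondegenerate type (cyclic over `ℚ` or a real quadratic field).**  For a SIMPLE abelian
variety `X` of dimension `2^n` with `φ : F →+* End⁰(X)`, `F` an abelian CM field of degree `2^{n+1}` cyclic over a
subfield `L ⊆ F⁺` of degree `≤ 2`: there is `X′` isogenous to `X` realising a NONDEGENERATE CM type of `F`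
(Shimura's principal pair + part Ib). [cite: Shimura1998, §7.1 Prop. 7 and §5.2] [cite: Kubota1965, §4 Lemma 2] -/
theorem exists_isIsogenous_realisation_isNondegenerate_of_isCyclic_over
    (hcomm : ∀ g h : F ≃ₐ[ℚ] F, g * h = h * g) {n : ℕ} (hF : Module.finrank ℚ F = 2 ^ (n + 1))
    (L : IntermediateField ℚ F) (hL : Module.finrank ℚ L ≤ 2) (hLreal : ∀ x ∈ L, IsCMField.complexConj F x = x)
    (hcyc : IsCyclic (F ≃ₐ[L] F)) {X : AbelianVariety ℂ} (hXs : X.IsSimple) (hX : X.dim = 2 ^ n)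
    (φ : F →+* X.endAlgebra) :
    ∃ (X' : AbelianVariety ℂ) (Φ : CMType F) (ι : 𝓞 F →+* End X')
      (θ : F →+* Module.End ℂ (complexBetti X'.X 1)),
      IsIsogenous X X' ∧ IsCMTypeRealisation Φ X' ι θ ∧ IsNondegenerate Φ := by
  obtain ⟨X', φ', ι', hφι, f, hf⟩ := exists_principal_pair φ
  have hdim' : Module.finrank ℚ F = 2 * X'.dim := by rw [hF, ← dim_eq_of_isIsogeny hf, hX, pow_succ, mul_comm]
  have hreal := isCMTypeRealisation_cmTypeOfPair φ' hdim' ι' hφι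
  obtain ⟨s₀⟩ := (inferInstance : Nonempty (F →+* ℂ))
  exact ⟨X', _, ι', _, ⟨f, hf⟩, hreal, isNondegenerate_of_isPrimitive_of_isCyclic_over hcomm hF L hL hLreal hcyc s₀
    ((isSimple_iff_isPrimitive hreal s₀).1 (hXs.of_isIsogeny hf))⟩

/-- **Principal model with a nondegenerate type (degree `16`, squares in `{1, c}`).**  The same for `F` abelian CM
of degree `16` all of whose Galois automorphisms square to `1` or to complex conjugation, `X` a simple eightfold
(part IIc). [cite: Shimura1998, §7.1 Prop. 7 and §5.2] [cite: Kubota1965, §4 Lemma 2] -/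
theorem exists_isIsogenous_realisation_isNondegenerate_of_sq_eq_one_or_conj
    (hcomm : ∀ g h : F ≃ₐ[ℚ] F, g * h = h * g) (hF : Module.finrank ℚ F = 16)
    (hsq : ∀ g : F ≃ₐ[ℚ] F, g * g = 1 ∨ g * g = (IsCMField.complexConj F).restrictScalars ℚ)
    {X : AbelianVariety ℂ} (hXs : X.IsSimple) (hX : X.dim = 8) (φ : F →+* X.endAlgebra) :
    ∃ (X' : AbelianVariety ℂ) (Φ : CMType F) (ι : 𝓞 F →+* End X')
      (θ : F →+* Module.End ℂ (complexBetti X'.X 1)),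
      IsIsogenous X X' ∧ IsCMTypeRealisation Φ X' ι θ ∧ IsNondegenerate Φ := by
  obtain ⟨X', φ', ι', hφι, f, hf⟩ := exists_principal_pair φ
  have hdim' : Module.finrank ℚ F = 2 * X'.dim := by rw [hF, ← dim_eq_of_isIsogeny hf, hX]
  have hreal := isCMTypeRealisation_cmTypeOfPair φ' hdim' ι' hφι
  obtain ⟨s₀⟩ := (inferInstance : Nonempty (F →+* ℂ))
  exact ⟨X', _, ι', _, ⟨f, hf⟩, hreal, isNondegenerate_of_isPrimitive_of_sq_eq_one_or_conj hcomm hF hsq s₀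
    ((isSimple_iff_isPrimitive hreal s₀).1 (hXs.of_isIsogeny hf))⟩

/-! ### §2 `B = D` and the Hodge conjecture for everything isogenous to a power of `X` -/

/-- **`B = D` for every complex abelian variety isogenous to a power `X^{N+1}`** of a simple `2^n`-fold `X` with
`φ : F →+* End⁰(X)`, `F` abelian CM of degree `2^{n+1}` cyclic over `ℚ` or a real quadratic subfield (Hazama–Murty
via nondegeneracy; isogeny invariance of `B = D`). [cite: Gordon1999HodgeAVSurvey, Thm. 6.4 and 9.4]
[cite: vanGeemen1994HodgeAV, Lemma 3.7] -/
theorem isDivisorGenerated_of_isIsogenous_powSucc_of_ringHom_of_isCyclic_over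
    (hcomm : ∀ g h : F ≃ₐ[ℚ] F, g * h = h * g) {n : ℕ} (hF : Module.finrank ℚ F = 2 ^ (n + 1))
    (L : IntermediateField ℚ F) (hL : Module.finrank ℚ L ≤ 2) (hLreal : ∀ x ∈ L, IsCMField.complexConj F x = x)
    (hcyc : IsCyclic (F ≃ₐ[L] F)) {X : AbelianVariety ℂ} (hXs : X.IsSimple) (hX : X.dim = 2 ^ n)
    (φ : F →+* X.endAlgebra) {B : AbelianVariety ℂ} {N : ℕ} (h : IsIsogenous B (X.powSucc N)) :
    IsDivisorGenerated B := by
  obtain ⟨X', Φ, ι, θ, hXX', hreal, hΦ⟩ :=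
    exists_isIsogenous_realisation_isNondegenerate_of_isCyclic_over hcomm hF L hL hLreal hcyc hXs hX φ
  exact hΦ.isDivisorGenerated_of_isIsogenous_powSucc hreal (h.trans (isIsogenous_powSucc hXX' N))

/-- **The Hodge conjecture for every complex abelian variety isogenous to a power `X^{N+1}` of a SIMPLE abelian
variety `X` of dimension `2^n` carrying an action `φ : F →+* End⁰(X)` of an ABELIAN CM field `F` of degree `2^{n+1}`
which is CYCLIC over `ℚ` or over a REAL QUADRATIC subfield** — UNCONDITIONALLY.  (E.g. `F = ℚ(ζ₃₂ − ζ₃₂⁻¹, √3)`,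
`X` a simple eightfold.) [cite: Kubota1965, §4 Lemma 2] [cite: Gordon1999HodgeAVSurvey, Thm. 6.4]
[cite: vanGeemen1994HodgeAV, Lemma 3.7] [cite: Deligne2000, §1] -/
theorem hodgeConjectureFor_of_isIsogenous_powSucc_of_ringHom_of_isCyclic_over
    (hcomm : ∀ g h : F ≃ₐ[ℚ] F, g * h = h * g) {n : ℕ} (hF : Module.finrank ℚ F = 2 ^ (n + 1))
    (L : IntermediateField ℚ F) (hL : Module.finrank ℚ L ≤ 2) (hLreal : ∀ x ∈ L, IsCMField.complexConj F x = x)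
    (hcyc : IsCyclic (F ≃ₐ[L] F)) {X : AbelianVariety ℂ} (hXs : X.IsSimple) (hX : X.dim = 2 ^ n)
    (φ : F →+* X.endAlgebra) {B : AbelianVariety ℂ} {N : ℕ} (h : IsIsogenous B (X.powSucc N)) :
    HodgeConjectureFor B.dim B.X :=
  hodgeConjectureFor_of_isDivisorGenerated _
    (isDivisorGenerated_of_isIsogenous_powSucc_of_ringHom_of_isCyclic_over hcomm hF L hL hLreal hcyc hXs hX φ h)

/-- The variety itself (`N = 0`, `B = X`). [cite: Kubota1965, §4 Lemma 2] [cite: Deligne2000, §1] -/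
theorem hodgeConjectureFor_of_ringHom_of_isCyclic_over (hcomm : ∀ g h : F ≃ₐ[ℚ] F, g * h = h * g) {n : ℕ}
    (hF : Module.finrank ℚ F = 2 ^ (n + 1)) (L : IntermediateField ℚ F) (hL : Module.finrank ℚ L ≤ 2)
    (hLreal : ∀ x ∈ L, IsCMField.complexConj F x = x) (hcyc : IsCyclic (F ≃ₐ[L] F)) {X : AbelianVariety ℂ}
    (hXs : X.IsSimple) (hX : X.dim = 2 ^ n) (φ : F →+* X.endAlgebra) : HodgeConjectureFor X.dim X.X :=
  hodgeConjectureFor_of_isIsogenous_powSucc_of_ringHom_of_isCyclic_over hcomm hF L hL hLreal hcyc hXs hX φ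
    (N := 0) (IsIsogenous.refl X)

/-- **The Hodge conjecture for every complex abelian variety isogenous to a power `X^{N+1}` of a SIMPLE abelian
EIGHTFOLD `X` carrying an action `φ : F →+* End⁰(X)` of an abelian CM field `F` of degree `16` all of whose Galois
automorphisms square to `1` or to complex conjugation** — UNCONDITIONALLY. [cite: Kubota1965, §4 Lemma 2]
[cite: Gordon1999HodgeAVSurvey, Thm. 6.4] [cite: vanGeemen1994HodgeAV, Lemma 3.7] [cite: Deligne2000, §1] -/
theorem hodgeConjectureFor_of_isIsogenous_powSucc_of_ringHom_of_sq_eq_one_or_conj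
    (hcomm : ∀ g h : F ≃ₐ[ℚ] F, g * h = h * g) (hF : Module.finrank ℚ F = 16)
    (hsq : ∀ g : F ≃ₐ[ℚ] F, g * g = 1 ∨ g * g = (IsCMField.complexConj F).restrictScalars ℚ)
    {X : AbelianVariety ℂ} (hXs : X.IsSimple) (hX : X.dim = 8) (φ : F →+* X.endAlgebra)
    {B : AbelianVariety ℂ} {N : ℕ} (h : IsIsogenous B (X.powSucc N)) : HodgeConjectureFor B.dim B.X := by
  obtain ⟨X', Φ, ι, θ, hXX', hreal, hΦ⟩ :=
    exists_isIsogenous_realisation_isNondegenerate_of_sq_eq_one_or_conj hcomm hF hsq hXs hX φ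
  exact hodgeConjectureFor_of_isDivisorGenerated _
    (hΦ.isDivisorGenerated_of_isIsogenous_powSucc hreal (h.trans (isIsogenous_powSucc hXX' N)))

/-- **MULTIQUADRATIC CM fields of degree `16`**: the Hodge conjecture for everything isogenous to a power of a simple
eightfold `X` with `φ : F →+* End⁰(X)`, `F = ℚ(√d₁, √d₂, √d₃, √−m)` (every Galois automorphism an involution) —
UNCONDITIONALLY. [cite: Kubota1965, §4 Lemma 2] [cite: Deligne2000, §1] -/
theorem hodgeConjectureFor_of_isIsogenous_powSucc_of_ringHom_multiquadratic (hF : Module.finrank ℚ F = 16)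
    (hsq : ∀ g : F ≃ₐ[ℚ] F, g * g = 1) {X : AbelianVariety ℂ} (hXs : X.IsSimple) (hX : X.dim = 8)
    (φ : F →+* X.endAlgebra) {B : AbelianVariety ℂ} {N : ℕ} (h : IsIsogenous B (X.powSucc N)) :
    HodgeConjectureFor B.dim B.X := by
  -- a group of exponent `2` is commutative (tree `GaloisRepresentations.MultiQuadratic.mul_comm'`, inline)
  have hinv : ∀ x : F ≃ₐ[ℚ] F, x⁻¹ = x := fun x => inv_eq_of_mul_eq_one_right (hsq x)
  have hcomm : ∀ g g' : F ≃ₐ[ℚ] F, g * g' = g' * g := fun g g' =>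
    calc g * g' = (g * g')⁻¹ := (hinv _).symm
      _ = g'⁻¹ * g⁻¹ := mul_inv_rev g g'
      _ = g' * g := by rw [hinv, hinv]
  exact hodgeConjectureFor_of_isIsogenous_powSucc_of_ringHom_of_sq_eq_one_or_conj hcomm hF
    (fun g => Or.inl (hsq g)) hXs hX φ h

/-! ### §3 Class-target displays (`HCOnClass`) -/

/-- **HC on the class «isogenous to a power of a simple abelian `2^n`-fold with an action of an abelian CM field of
degree `2^{n+1}` cyclic over `ℚ` or over a real quadratic subfield»**, UNCONDITIONAL. [cite: Kubota1965, §4 Lemma 2]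
[cite: Deligne2000, §1] -/
theorem hcOnClass_isIsogenous_powSucc_simple_abelianTwoPowerCM_cyclicOverReal :
    HCOnClass fun B ↦ ∃ (X : AbelianVariety ℂ) (N n : ℕ) (F : Type) (_ : Field F) (_ : NumberField F)
      (_ : IsCMField F) (_ : IsGalois ℚ F) (L : IntermediateField ℚ F), X.IsSimple ∧ X.dim = 2 ^ n ∧
      Module.finrank ℚ F = 2 ^ (n + 1) ∧ (∀ g h : F ≃ₐ[ℚ] F, g * h = h * g) ∧ Module.finrank ℚ L ≤ 2 ∧
      (∀ x ∈ L, IsCMField.complexConj F x = x) ∧ IsCyclic (F ≃ₐ[L] F) ∧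
      Nonempty (F →+* X.endAlgebra) ∧ IsIsogenous B (X.powSucc N) := by
  rintro B ⟨X, N, n, F, _, _, _, _, L, hXs, hX, hF, hcomm, hL, hLreal, hcyc, ⟨φ⟩, h⟩
  exact hodgeConjectureFor_of_isIsogenous_powSucc_of_ringHom_of_isCyclic_over hcomm hF L hL hLreal hcyc hXs hX φ h

/-- **HC on the class «isogenous to a power of a simple abelian eightfold with an action of a multiquadratic CM field
of degree `16`»**, UNCONDITIONAL. [cite: Kubota1965, §4 Lemma 2] [cite: Deligne2000, §1] -/
theorem hcOnClass_isIsogenous_powSucc_simpleEightfold_multiquadraticCM :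
    HCOnClass fun B ↦ ∃ (X : AbelianVariety ℂ) (N : ℕ) (F : Type) (_ : Field F) (_ : NumberField F)
      (_ : IsCMField F) (_ : IsGalois ℚ F), X.IsSimple ∧ X.dim = 8 ∧ Module.finrank ℚ F = 16 ∧
      (∀ g : F ≃ₐ[ℚ] F, g * g = 1) ∧ Nonempty (F →+* X.endAlgebra) ∧ IsIsogenous B (X.powSucc N) := by
  rintro B ⟨X, N, F, _, _, _, _, hXs, hX, hF, hsq, ⟨φ⟩, h⟩
  exact hodgeConjectureFor_of_isIsogenous_powSucc_of_ringHom_multiquadratic hF hsq hXs hX φ h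

/-- **HC on the class «isogenous to a power of a simple abelian eightfold with an action of an abelian CM field of
degree `16` all of whose Galois automorphisms square to `1` or to complex conjugation»**, UNCONDITIONAL.
[cite: Kubota1965, §4 Lemma 2] [cite: Deligne2000, §1] -/
theorem hcOnClass_isIsogenous_powSucc_simpleEightfold_abelianCM_sqInConj :
    HCOnClass fun B ↦ ∃ (X : AbelianVariety ℂ) (N : ℕ) (F : Type) (_ : Field F) (_ : NumberField F)
      (_ : IsCMField F) (_ : IsGalois ℚ F), X.IsSimple ∧ X.dim = 8 ∧ Module.finrank ℚ F = 16 ∧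
      (∀ g h : F ≃ₐ[ℚ] F, g * h = h * g) ∧
      (∀ g : F ≃ₐ[ℚ] F, g * g = 1 ∨ g * g = (IsCMField.complexConj F).restrictScalars ℚ) ∧
      Nonempty (F →+* X.endAlgebra) ∧ IsIsogenous B (X.powSucc N) := by
  rintro B ⟨X, N, F, _, _, _, _, hXs, hX, hF, hcomm, hsq, ⟨φ⟩, h⟩
  exact hodgeConjectureFor_of_isIsogenous_powSucc_of_ringHom_of_sq_eq_one_or_conj hcomm hF hsq hXs hX φ h

end Summit.HodgeConjecture.CorCM.ThinKernel

end
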